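import Literature.MathematicalPhysics.QuantumFieldTheory.Balaban1983to89.B9Thm312WholeLeft

/-!
# `Balaban1983to89.B9Ineq347CoReading` — [B9] p. 398 «(3.47) are consequences of (3.42) and Lemma 2.1» from the MODEL OPERATOR'S
# [4]-(2.51) block majorant and a (3.47) CO-READING — no reading axiom about the abstract family, no orphan phenomenon

T. Bałaban, *Propagators for lattice gauge theories in a background field*, Commun. Math. Phys. **99** (1985) 389–434
[`Balaban1985BackgroundPropagators`, "B9"]; [4] = T. Bałaban, *Propagators and renormalization transformations for lattice gauge
theories. II*, Commun. Math. Phys. **96** (1984) 223–250 [`Balaban1984PropagatorsII`].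

statement-level skeleton of published theorems with citation tags; proofs where landed; nothing here is a claim about the
Yang–Mills mass gap

THE PRINTED LOCI.  (3.41) p. 397 *"|A|_{(α)} = sup_j sup_{b ∈ Ω_j∖Ω_{j+1}} (Lʲη)^{−α}|A(b)| … the smallest number C such, that |A(b)| ≦
C(Lʲη)^α"*; (3.42) p. 397; (3.47) p. 398; p. 398 *"It is easy to see that the global inequalities (3.47) are consequences of the local
ones (3.42) and Lemma 2.1."*; [4] (2.51)–(2.52) p. 232 (the block majorant *"|(Tλ)(x)| ≦ K(y, y′)|λ|, x ∈ B^j(y), supp λ ⊂ B^{j′}(y′)"*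
and λ = Σ_{y′}Δ(y′)λ), Lemma 2.1 (2.60)–(2.61) p. 234.

WHY THIS FILE (the successor of `B9Thm312WholeLeft.globEntry_of_clause342`).  That theorem derives the n-th (3.47) entry of an ABSTRACT
kernel family `K` from its n-th (3.42) clause `Clause342 K n B δ U` and n06-h's READING AXIOMS `B9Ineq347Reading.GlobReading K P U res`
(block pieces indexed by the SITES of the geometry, sub-additivity of the readings, `glob_le`).  At the geometry of record the sites are
the index bonds and `GlobReading` has NO instance face — a block of 𝔅 that is the carrier block of no index bond is invisible to every
(3.42) reading while (3.47) reads every fine bond (`B9GlobReadingOrphan.not_hRGA_opsYOfLetters_of_orphan`, cell memo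
`ORPHAN-BLOCKS-MEMO.md`).  THIS FILE runs print's sentence ONE LEVEL DOWN, on the MODEL OPERATOR `A : (v → ℝ) →ₗ (u → ℝ)` of the letter
record (real coordinate lattices `v`, `u` with TOTAL block maps `bv`, `bu` — every coordinate has a block, nothing is orphan): from the
[4]-(2.51) majorant `HasMajorantHom bv bu A (maj342 g n B₀ δ)` (which the Theorem-3.12∕3.13 leaves PROVE for G, ∇G, G∇*, G₁, …, 𝔊 at
one U), λ = Σ_{y′}Δ(y′)λ on the model lattice ([4] (2.52), `B6RandomWalk.sum_blockPiece`), the scale transfer (2.60) and the row sum (2.61),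
it bounds `|(A f)(x)|` by `B₀cL⁴·[(L^jη)², L^jη, L^jη, 1]_n(L^jη)^γ·‖f‖` for EVERY coordinate x with the model-side weighted size
`‖f‖ := sup_x′ (L^{j(x′)}η)^{−γ}|f(x′)|` — and hands the result to the family through a CO-READING `CoReadsGlob K n U bu bv ev A` of the
same species as `B9Thm37GlueCor36.CoRealizes` (the (3.42) co-reading the leaves already take): `wbound` (|ev λ (x′)| ≦ (L^{j(x′)}η)^γ|λ|_{(γ)}:
the pointwise form of (3.41) read through `bv`) and `obs` (the (3.47) reading `K.glob n U λ γ` is ≦ C as soon as |(A(ev λ))(x)| ≦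
C·[…]_n(L^{j(x)}η)^γ for every x: (3.41) «the smallest number C such that …» read through `bu`).  Both fields are dischargeable at an
instance whose block maps are level-faithful (the pattern of `CoRealizes.obs`); neither is asserted here.
* §1 `CoReadsGlob` (hypothesis schema), `abs_le_sum_of_hasMajorantHom` ([4] (2.52) + (2.51), two lattices).
* §2 ★ `glob_of_hasMajorantHom` — ONE ENTRY n of (3.47) for ALL arguments λ and γ ∈ [−4, 4] from the model majorant, (2.60) at (δ, α), the
  row sum at (1 − α)δ with a GENERIC constant c, 4·log L ≦ αδRM, L ≧ 1, η > 0, |·|_{(γ)} ≧ 0 and the co-reading: `K.glob n U λ γ ≦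
  (B₀·c·L⁴)·|λ|_{(γ)}` — NO sub-family `P`, NO null reading, NO `res`.
* §3 `glob_of_hasMajorant` (u = v, one block map) and the constant-monotone feeders `hasMajorantHom_maj342_of_le`.

HONEST SCOPE.  Nothing of [B9] or [4] asserted: the majorant, Lemma 2.1 and the two co-reading fields are HYPOTHESES of printed ∕
definitional shape; the content is print's «easy to see» bookkeeping on the model lattice, kernel-checked.  NOT a node discharge;
count-neutral; one finite lattice at a time; nothing continuum, nothing about the mass gap.  Cell `pub-ymgap` (HUMAN RULING D-0062), Track A
node N06 [B9], N06-ASSIGNMENT v1 rows 20–21 (bundle F7), seat `pub-ymgap-dag-n06-l` (g3), 2026-08-27.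
-/

namespace Literature.MathematicalPhysics.QuantumFieldTheory.Balaban1983to89.B9Ineq347CoReading

open Literature.MathematicalPhysics.QuantumFieldTheory.Balaban1983to89
open Finset B6RandomWalk B6RandomWalkHom B9Thm34Ext B9Thm37GlueCor36 B11SectG B9SectCDiffDict
open B9FromB6 B9Thm312Whole B9Thm312WholeLeft

noncomputable section

/-! ## §1 The (3.47) co-reading of a kernel family by a model operator (hypothesis schema; nothing asserted) -/

section CoReading

variable {g : B9.Geometry} [Fintype g.Site] {R : ℝ} {H : Prop} {B : B9.Backgrounds}
variable {u v : Type}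

/-- **CO-READING OF THE n-TH GLOBAL QUANTITY (3.47) BY A MODEL OPERATOR** (the (3.47) companion of `B9Thm37GlueCor36.CoRealizes`).
Print, (3.41) p. 397: *"|A|_{(α)} = sup_j sup_{b ∈ Ω_j∖Ω_{j+1}} (Lʲη)^{−α}|A(b)| … the smallest number C such, that |A(b)| ≦ C(Lʲη)^α"*,
and (3.47): the bounded quantity is |word_n A(U)λ|_{(p_n+γ)}, p = (2, 1, 1, 0).  Typed: `ev λ` evaluates the abstract argument on the
model lattice `v`, whose coordinates carry blocks `bv x′` (a TOTAL map); `wbound` — |ev λ (x′)| ≦ (L^{j(bv x′)}η)^γ|λ|_{(γ)} (the pointwise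
form of (3.41)); `obs` — `K.glob n U λ γ ≦ C` whenever |(A(ev λ))(x)| ≦ C·[(L^jη)², L^jη, L^jη, 1]_n·(L^{j(bu x)}η)^γ for every coordinate x
of the target lattice `u` («the smallest number C such that …»).  OURS (typing): a hypothesis schema on how a model instantiates
`B9.Geometry.wNorm` ∕ `B9.KernelFamily.glob`; dischargeable at level-faithful block maps; nothing asserted.
[cite: Balaban1985BackgroundPropagators, (3.41) p.397 + (3.47) p.398] -/
structure CoReadsGlob (K : B9.KernelFamily g B) (n : Fin 4) (U : B.Cfg) (bu : u → g.Site) (bv : v → g.Site)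
    (ev : g.Loc → v → ℝ) (A : (v → ℝ) →ₗ[ℝ] (u → ℝ)) : Prop where
  wbound : ∀ (lam : g.Loc) (γ : ℝ) (x' : v), |ev lam x'| ≤ g.len (bv x') ^ γ * g.wNorm γ lam
  obs : ∀ (lam : g.Loc) (γ C : ℝ), 0 ≤ C →
    (∀ x : u, |A (ev lam) x| ≤ C * B9.pref4 (g.len (bu x)) n * g.len (bu x) ^ γ) → K.glob n U lam γ ≤ C

omit [Fintype g.Site] in
/-- the co-reading is monotone in nothing and needs no side condition; recorded: its `obs` field at a bound that is not
nonnegative is never used. [cite: Balaban1985BackgroundPropagators, (3.41) p.397, bookkeeping] -/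
theorem CoReadsGlob.obs' {K : B9.KernelFamily g B} {n : Fin 4} {U : B.Cfg} {bu : u → g.Site} {bv : v → g.Site}
    {ev : g.Loc → v → ℝ} {A : (v → ℝ) →ₗ[ℝ] (u → ℝ)} (h : CoReadsGlob K n U bu bv ev A) (lam : g.Loc) (γ : ℝ) {C : ℝ}
    (hC : 0 ≤ C) (hx : ∀ x : u, |A (ev lam) x| ≤ C * B9.pref4 (g.len (bu x)) n * g.len (bu x) ^ γ) :
    K.glob n U lam γ ≤ C :=
  h.obs lam γ C hC hx

/-- **[4] (2.52) + (2.51) ON TWO LATTICES**: λ = Σ_{y′}Δ(y′)λ on the source lattice (total block map `bv`), the majorant block by block: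
`|(Af)(x)| ≦ Σ_{y′} K(bu x, y′)·W(y′)` whenever `|f(x′)| ≦ W(bv x′)` pointwise (W ≧ 0).  (The one-lattice case is
`B9Thm314GpFlatResolvent.abs_le_sum_of_hasMajorant`.) [cite: Balaban1984PropagatorsII, (2.51)–(2.52) p.232] -/
theorem abs_le_sum_of_hasMajorantHom {G : B6.Geometry} {bu : u → G.Site} {bv : v → G.Site}
    {A : (v → ℝ) →ₗ[ℝ] (u → ℝ)} {K : G.Site → G.Site → ℝ} (hA : HasMajorantHom bv bu A K) (f : v → ℝ) (W : G.Site → ℝ)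
    (hW0 : ∀ b, 0 ≤ W b) (hW : ∀ z, |f z| ≤ W (bv z)) (x : u) : |A f x| ≤ ∑ b, K (bu x) b * W b := by
  classical
  have hf : f = ∑ b, blockPiece bv b f := (sum_blockPiece bv f).symm
  have hpiece : ∀ b, BlockSupp bv (blockPiece bv b f) b (W b) := fun b =>
    { nonneg := hW0 b
      bound := fun z hz => by
        simp only [blockPiece, hz, if_true]
        exact hz ▸ hW z
      off := fun z hz => by simp only [blockPiece, hz, if_false] }
  have hAf : A f = ∑ b, A (blockPiece bv b f) := by
    conv_lhs => rw [hf]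
    rw [map_sum]
  calc |A f x| = |(∑ b, A (blockPiece bv b f)) x| := by rw [hAf]
    _ = |∑ b, A (blockPiece bv b f) x| := by rw [Finset.sum_apply]
    _ ≤ ∑ b, |A (blockPiece bv b f) x| := Finset.abs_sum_le_sum_abs _ _
    _ ≤ ∑ b, K (bu x) b * W b := Finset.sum_le_sum fun b _ => hA b _ _ (hpiece b) x

end CoReading

/-! ## §2 ★ One entry of (3.47) from the model operator's (3.42) majorant, Lemma 2.1 and the co-reading -/

section Glob

variable {g : B9.Geometry} [Fintype g.Site] {B : B9.Backgrounds} {R : ℝ} {H : Prop}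
variable {u v : Type}

omit [Fintype g.Site] in
/-- Lʲη ≥ 0 for L ≥ 1, η > 0. [folklore] -/
private theorem len_nonneg_of (hL : 1 ≤ g.L) (hη : 0 < g.eta) (y : g.Site) : 0 ≤ g.len y :=
  mul_nonneg (pow_nonneg (le_trans zero_le_one hL) _) hη.le

/-- ★ **«THE GLOBAL INEQUALITIES (3.47) ARE CONSEQUENCES OF THE LOCAL ONES (3.42) AND LEMMA 2.1» — ONE ENTRY, FROM THE MODEL OPERATOR'S
BLOCK MAJORANT, FOR ALL ARGUMENTS.**  For a kernel family `K` co-read at the entry n by the model operator `A` (`CoReadsGlob K n U bu bv ev A`):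
the [4]-(2.51) majorant `maj342 g n B₀ δ` of `A` (= the n-th (3.42) bound B₀[(L^jη)², L^jη, L^jη, 1]_n e^{−δd(y,y′)} between the blocks of
the TOTAL block maps `bv`, `bu`; B₀ ≧ 0), (2.60) at (δ, α) and the row sum (2.61) at (1 − α)δ with constant c ≧ 0 for the transported geometry,
L ≧ 1, η > 0, 4·log L ≦ αδRM and |·|_{(γ)} ≧ 0 give `K.glob n U λ γ ≦ (B₀·c·L⁴)·|λ|_{(γ)}` for EVERY λ and γ ∈ [−4, 4].  Route = print's:
f = ev λ = Σ_{y′}Δ(y′)f on the model lattice, the majorant on each piece with |Δ(y′)f| ≦ (L^{j′}η)^γ|λ|_{(γ)} (`wbound`), e^{−δd} =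
e^{−(1−α)δd}·e^{−αδd}, the scale transfer (L^{j′}η)^γ ≦ L^{|γ|}e^{αδd}(L^jη)^γ by (2.60) under the size condition, the row sum, then `obs`.
[cite: Balaban1985BackgroundPropagators, (3.41)–(3.42) p.397 + (3.47) p.398; Balaban1984PropagatorsII, (2.51)–(2.52) p.232 + Lemma 2.1 (2.60)–(2.61) p.234] -/
theorem glob_of_hasMajorantHom {K : B9.KernelFamily g B} {n : Fin 4} {U : B.Cfg} {bu : u → g.Site} {bv : v → g.Site}
    {ev : g.Loc → v → ℝ} {A : (v → ℝ) →ₗ[ℝ] (u → ℝ)} (hco : CoReadsGlob K n U bu bv ev A) {B₀ δ α c : ℝ}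
    (hA : HasMajorantHom (g := toB6 g R H) bv bu A (maj342 g n B₀ δ)) (hB₀ : 0 ≤ B₀) (hc : 0 ≤ c) (hL : 1 ≤ g.L)
    (hη : 0 < g.eta) (hw : ∀ (γ : ℝ) (lam : g.Loc), 0 ≤ g.wNorm γ lam) (hsize : 4 * Real.log g.L ≤ α * δ * R * g.M)
    (h260 : Ineq260 (toB6 g R H) δ α) (hrow : RowSum (toB6 g R H) ((1 - α) * δ) c) :
    ∀ (lam : g.Loc) (γ : ℝ), -4 ≤ γ → γ ≤ 4 → K.glob n U lam γ ≤ (B₀ * c * g.L ^ (4 : ℝ)) * g.wNorm γ lam := by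
  intro lam γ h1 h2
  have hγ : |γ| ≤ 4 := abs_le.2 ⟨by linarith, h2⟩
  have hL0 : 0 < g.L := lt_of_lt_of_le one_pos hL
  obtain ⟨hsz, hL4⟩ := B9Ineq347AllEntries.size_condition_compact g.L γ _ hL hγ hsize
  have hST : B9Ineq347.ScaleTransfer g δ α (g.L ^ |γ|) (fun y => (g.len y) ^ γ) :=
    B9Ineq347.scaleTransfer_of_260 g δ α (Real.exp (-(α * δ * R * g.M))) (g.L ^ |γ|) (fun y => (g.len y) ^ γ)
      (fun y y' => Nat.dist (g.scale y) (g.scale y')) (Real.exp_nonneg _) (Real.one_le_rpow hL (abs_nonneg γ))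
      (B9Ineq347AllEntries.rpow_abs_mul_exp_le_one g.L γ _ hL0 hsz) (B9Ineq347AllEntries.weight_nonneg g hL0 hη γ)
      (B9Ineq347AllEntries.h260_nat_of_Ineq260 g R H δ α h260) (fun y y' => B9Ineq347AllEntries.weight_ratio g hL hη γ y y')
  set N := g.wNorm γ lam with hNdef
  have hN : 0 ≤ N := hw γ lam
  have hΛ : 0 ≤ g.L ^ |γ| := Real.rpow_nonneg hL0.le _
  have hC : 0 ≤ B₀ * c * g.L ^ (4 : ℝ) * N :=
    mul_nonneg (mul_nonneg (mul_nonneg hB₀ hc) (Real.rpow_nonneg hL0.le _)) hN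
  refine hco.obs lam γ _ hC fun x => ?_
  set y := bu x with hydef
  have hpref : 0 ≤ B9.pref4 (g.len y) n := B9FromB6.pref4_nonneg (len_nonneg_of hL hη y) n
  have hwy : 0 ≤ (g.len y) ^ γ := B9Ineq347AllEntries.weight_nonneg g hL0 hη γ y
  have hK : 0 ≤ B₀ * B9.pref4 (g.len y) n * N := mul_nonneg (mul_nonneg hB₀ hpref) hN
  -- the block decomposition of f = ev λ on the model lattice and the majorant, piece by piece
  have hW0 : ∀ b : g.Site, 0 ≤ (g.len b) ^ γ * N := fun b => mul_nonneg (B9Ineq347AllEntries.weight_nonneg g hL0 hη γ b) hN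
  have hsum := abs_le_sum_of_hasMajorantHom (G := toB6 g R H) hA (ev lam) (fun b => (g.len b) ^ γ * N) hW0
    (fun z => hco.wbound lam γ z) x
  -- the exponential split e^{−δd} = e^{−(1−α)δd}·e^{−αδd}
  have hsplit : ∀ y' : g.Site, Real.exp (-(δ * g.dist y y')) =
      Real.exp (-((1 - α) * δ * g.dist y y')) * Real.exp (-(α * δ * g.dist y y')) := by
    intro y'
    rw [← Real.exp_add]
    congr 1
    ring
  calc |A (ev lam) x| ≤ ∑ y' : g.Site, maj342 g n B₀ δ (bu x) y' * ((g.len y') ^ γ * N) := hsum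
    _ = B₀ * B9.pref4 (g.len y) n * N * ∑ y' : g.Site, Real.exp (-((1 - α) * δ * g.dist y y')) *
          (Real.exp (-(α * δ * g.dist y y')) * (g.len y') ^ γ) := by
        rw [Finset.mul_sum]
        refine Finset.sum_congr rfl fun y' _ => ?_
        rw [← hydef, maj342, hsplit y']
        ring
    _ ≤ B₀ * B9.pref4 (g.len y) n * N * ∑ y' : g.Site, Real.exp (-((1 - α) * δ * g.dist y y')) *
          (g.L ^ |γ| * (g.len y) ^ γ) := by
        refine mul_le_mul_of_nonneg_left (Finset.sum_le_sum fun y' _ => ?_) hK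
        exact mul_le_mul_of_nonneg_left (hST y y') (Real.exp_nonneg _)
    _ = B₀ * B9.pref4 (g.len y) n * N * (g.L ^ |γ| * (g.len y) ^ γ) *
          ∑ y' : g.Site, Real.exp (-((1 - α) * δ * g.dist y y')) := by
        rw [← Finset.sum_mul]
        ring
    _ ≤ B₀ * B9.pref4 (g.len y) n * N * (g.L ^ |γ| * (g.len y) ^ γ) * c :=
        mul_le_mul_of_nonneg_left (hrow y) (mul_nonneg hK (mul_nonneg hΛ hwy))
    _ = (B₀ * c * g.L ^ |γ| * N) * B9.pref4 (g.len y) n * (g.len y) ^ γ := by ring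
    _ ≤ (B₀ * c * g.L ^ (4 : ℝ) * N) * B9.pref4 (g.len y) n * (g.len y) ^ γ := by
        have h4 : B₀ * c * g.L ^ |γ| * N ≤ B₀ * c * g.L ^ (4 : ℝ) * N :=
          mul_le_mul_of_nonneg_right (mul_le_mul_of_nonneg_left hL4 (mul_nonneg hB₀ hc)) hN
        exact mul_le_mul_of_nonneg_right (mul_le_mul_of_nonneg_right h4 hpref) hwy

/-- The one-lattice form (u = v, one block map; e.g. the entry n = 0 of G, or n = 3). [cite: Balaban1985BackgroundPropagators, (3.47) p.398 (bookkeeping)] -/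
theorem glob_of_hasMajorant {K : B9.KernelFamily g B} {n : Fin 4} {U : B.Cfg} {blk : v → g.Site}
    {ev : g.Loc → v → ℝ} {A : Module.End ℝ (v → ℝ)} (hco : CoReadsGlob K n U blk blk ev A) {B₀ δ α c : ℝ}
    (hA : HasMajorant (g := toB6 g R H) blk A (maj342 g n B₀ δ)) (hB₀ : 0 ≤ B₀) (hc : 0 ≤ c) (hL : 1 ≤ g.L)
    (hη : 0 < g.eta) (hw : ∀ (γ : ℝ) (lam : g.Loc), 0 ≤ g.wNorm γ lam) (hsize : 4 * Real.log g.L ≤ α * δ * R * g.M)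
    (h260 : Ineq260 (toB6 g R H) δ α) (hrow : RowSum (toB6 g R H) ((1 - α) * δ) c) :
    ∀ (lam : g.Loc) (γ : ℝ), -4 ≤ γ → γ ≤ 4 → K.glob n U lam γ ≤ (B₀ * c * g.L ^ (4 : ℝ)) * g.wNorm γ lam :=
  glob_of_hasMajorantHom hco ((hasMajorantHom_iff (g := toB6 g R H) blk A _).2 hA) hB₀ hc hL hη hw hsize h260 hrow

/-! ## §3 Feeding the majorant: from the leaves' output shapes to `maj342 g n B δ` with a larger constant -/

/-- entry 0: `C·(L^jη)²·e^{−δd}` with `0 ≤ C ≤ B` gives `maj342 g 0 B δ` (L^jη ≧ 0). [cite: Balaban1985BackgroundPropagators, (3.42) p.397 (bookkeeping)] -/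
theorem hasMajorantHom_maj342_zero_of_le {bu : u → g.Site} {bv : v → g.Site} {A : (v → ℝ) →ₗ[ℝ] (u → ℝ)} {C B₁ δ : ℝ}
    (hA : HasMajorantHom (g := toB6 g R H) bv bu A (fun a b => C * g.len a ^ 2 * Real.exp (-(δ * g.dist a b))))
    (hCB : C ≤ B₁) : HasMajorantHom (g := toB6 g R H) bv bu A (maj342 g 0 B₁ δ) := by
  rw [maj342_zero]
  exact hasMajorantHom_mono (g := toB6 g R H) bv bu hA fun a b =>
    mul_le_mul_of_nonneg_right (mul_le_mul_of_nonneg_right hCB (sq_nonneg _)) (Real.exp_nonneg _)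

/-- entry 1: `C·(L^jη)·e^{−δd}` with `0 ≤ C ≤ B` gives `maj342 g 1 B δ`. [cite: Balaban1985BackgroundPropagators, (3.42) p.397 (bookkeeping)] -/
theorem hasMajorantHom_maj342_one_of_le {bu : u → g.Site} {bv : v → g.Site} {A : (v → ℝ) →ₗ[ℝ] (u → ℝ)} {C B₁ δ : ℝ}
    (hA : HasMajorantHom (g := toB6 g R H) bv bu A (fun a b => C * g.len a * Real.exp (-(δ * g.dist a b))))
    (hCB : C ≤ B₁) (hlen : ∀ y, 0 ≤ g.len y) : HasMajorantHom (g := toB6 g R H) bv bu A (maj342 g 1 B₁ δ) := by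
  rw [maj342_one]
  exact hasMajorantHom_mono (g := toB6 g R H) bv bu hA fun a b =>
    mul_le_mul_of_nonneg_right (mul_le_mul_of_nonneg_right hCB (hlen a)) (Real.exp_nonneg _)

/-- entry 2: `C·(L^jη)·e^{−δd}` with `0 ≤ C ≤ B` gives `maj342 g 2 B δ`. [cite: Balaban1985BackgroundPropagators, (3.42) p.397 (bookkeeping)] -/
theorem hasMajorantHom_maj342_two_of_le {bu : u → g.Site} {bv : v → g.Site} {A : (v → ℝ) →ₗ[ℝ] (u → ℝ)} {C B₁ δ : ℝ}
    (hA : HasMajorantHom (g := toB6 g R H) bv bu A (fun a b => C * g.len a * Real.exp (-(δ * g.dist a b))))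
    (hCB : C ≤ B₁) (hlen : ∀ y, 0 ≤ g.len y) : HasMajorantHom (g := toB6 g R H) bv bu A (maj342 g 2 B₁ δ) := by
  rw [maj342_two]
  exact hasMajorantHom_mono (g := toB6 g R H) bv bu hA fun a b =>
    mul_le_mul_of_nonneg_right (mul_le_mul_of_nonneg_right hCB (hlen a)) (Real.exp_nonneg _)

end Glob

end

end Literature.MathematicalPhysics.QuantumFieldTheory.Balaban1983to89.B9Ineq347CoReading
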